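import Summits.AtomisticToContinuum.FouriersLaw.Theorems.BondHeatUncertaintySubdiffusiveBondHeatEscapeGrading
import Summits.AtomisticToContinuum.FouriersLaw.Theorems.BondHeatUncertaintySubdiffusiveBondHeatOhmicFloorNecessary
import Summits.AtomisticToContinuum.FouriersLaw.Theorems.BondHeatUncertaintySubdiffusiveBondHeatDeficitCesaroLinear
import Summits.AtomisticToContinuum.FouriersLaw.Theorems.BondHeatUncertaintySubdiffusiveBondHeatEscapeDeficitNonneg
import Summits.AtomisticToContinuum.FouriersLaw.Theorems.BondHeatUncertaintyBoundedResponseTransientContactBudget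
import Summits.AtomisticToContinuum.FouriersLaw.Theses.GriffithsLimitExchange
import Summits.AtomisticToContinuum.FouriersLaw.Theorems.BondHeatUncertaintySubdiffusiveBondHeatOfContactWarburgModulus

/-!
(SPLIT FOR THE 400-LINE CAP by the landing lane, hand-2 g35: this file = part 1 of 5; sequels `…BondHeatUncertaintyBoundedResponseTransientBandB`, `…BondHeatUncertaintyBoundedResponseTransientBandC`, `…BondHeatUncertaintyBoundedResponseTransientBandD`, `…BondHeatUncertaintyBoundedResponseTransientBand` import it in a chain; same namespace, all FQNs unchanged.)
# `TransientBand` — the blocker `BoundedResponse` (11071) split at the Thouless time by the escape transient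
(lens-1 «grading», gen 92, node B — the door of record; node A `…TransientContactSpectrum` grades its floor piece from the junction side)

Node of the N_F branch (`FouriersLaw`), RESIDUAL MODE, blocker `BondHeatUncertainty.BoundedResponse`
(stmt-AtomisticToContinuum-11071) ⟺ `EscapeGrading.OhmicFloor` (`E_N(T) ≤ C₁(T)/N`, tree).  Currency: VERBATIM the escape objects of
route `BoundaryEscapeDeficit` — boundary kernel `K_N` (`escapeKernel`), step response `θ_N(s) = (γ/T²)∫₀ˢK_N` (`stepResponse`),
escape deficit `E_N = 1 − θ_N(∞)` (`EscapeGrading.escapeDeficit`, by name), Cesàro deficit `W_N(t) = ∫₀ᵗ(1 − θ_N)` (`deficitCesaro`,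
the functional of the registered open stub `stub_deficitCesaroEW` of crux 9120) — plus ONE named object, the ESCAPE TRANSIENT
`Ov_N(t) := (γ/T²)∫_{(0,∞)} min(u,t) K_N(u) du` (`escapeTransient`), which for `t ≥ 0` equals `W_N(t) − t·E_N = ∫₀ᵗ(θ_N(∞) − θ_N(s)) ds`
(`deficitCesaro_eq_add`, `integral_transient_eq`; tree triangle identity + `∫min(u,t)K = t∫K − ∫₀ᵗ(t−u)K`).

THE SPLIT (one line of algebra, `t = cN²`):  `cN²·E_N = W_N(cN²) − Ov_N(cN²)`.  Hence

  `BoundedResponse (11071) ⟸ DeficitCesaroPoint (D) ∧ TransientFloor 1 (F₁)`   (`boundedResponse_of_deficitCesaroPoint_transientFloor`)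

* (D) `W_N(cN²) ≤ C·N` for some `c > 0`, eventually in `N` — the 9120 stub AT ONE TIME (`deficitCesaroPoint_of_deficitCesaroEW`):
  STRICTLY WEAKER than the stub; FALSE for phonons (`W_N ≥ t/8`); the EW/«finite heat capacity, no ballistic leak» content.
* (F₁) `∀ c > 0: Ov_N(cN²) ≥ −C·N` eventually — no RETARDED OVERSHOOT of the contact temperature beyond the Ohmic scale; TRUE for
  phonons and under the Griffiths sign `BoundaryDEP` (13198, route `GriffithsLimitExchange`; even its tail form suffices:
  `transientFloor_of_boundaryDEP`, `transientFloor_of_kernelTail_nonneg`); implied by 11071 modulo the Cesàro floor `W_N(cN²) ≥ −C·N`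
  (`transientFloor_one_of_ohmicFloor_deficitCesaroFloor`; `deficitCesaroFloor_of_boundaryDEP`).  The two pieces are SEPARATED by the harmonic
  member (F₁ true, D false), and jointly, with the ceiling (U) `Ov_N(cN²) ≤ C·N` (= the tree's `TransientEW` at one time,
  `transientCeilingPoint_of_transientEW`), `BoundedResponse ⟺ DeficitCesaroPoint` (`boundedResponse_iff_deficitCesaroPoint`).
  Neither (K) `ExtensiveSnapshotIrreversibility` (9121) nor the TUR budget `K_T`, nor the block-energy statics `W`, nor the bond-heat
  variance (S) of gens 90–92A enter: for THIS junction the thermodynamic-uncertainty machinery is dominated by the identity above.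
* GRADED LADDER (lens-1): `TransientFloor g` (`Ov_N(cN²) ≥ −C·N^g`, larger `g` weaker, `transientFloor_mono`); for `g ≥ 1`,
  `(D) ∧ F_g ⟹ ExponentFloor (2 − g)` (`exponentFloor_of_deficitCesaroPoint_transientFloor`) — the ladder docks onto the tree's
  `EscapeGrading.ExponentFloor`: `g = 1` Ohmic (⟺ 11071 given D), `g = 3/2` the half-Ohmic rung, `g = 2` the free rung `ExponentFloor 0`;
  `g = 4` is free outright (Bochner: `Ov_N(t) ≥ −γt²`, not typed).  Every grade `g < 2` is UNDECIDED in general and TRUE under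
  `BoundaryDEP`; the sharp grade `g = 1` is the residual of record.  On the stub side the injection-exponent ladder
  `DeficitCesaroGrade h` (`W_N(cN²) ≤ C·N^h`; `h = 2` PROVED from the tree's `W_N(t) ≤ t`, `h = 1` = (D)) combines with it:
  `D_h ∧ F_g ⟹ ExponentFloor (2 − max g h)` (`exponentFloor_of_grades`) — any sub-ballistic pair of grades gives a positive escape exponent.
* JUNCTION SIDE (§6): the fixed-`N` identity (EI) `SurplusTransientIdentity`, `s_N(τ) = γ·Ov_N(τ) − (R_H(0) − R_H(τ))/(4T²)`
  (`s_N` = contact surplus of node A over `contactImbalanceCorr` of `…TransientContactBudget`, `R_H` = energy autocorrelation;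
  parallelogram law + reflection + `Σ = R_H''/γ²`; verified to `1e-4` in the exactly solvable member) and the statics
  `EnergyCorrelationDropLinear` (`|ΔR_H| ≤ 2Var_T(H_N) = O(N)`) make node A's `EquilibriumSurplusFloor` and `TransientFloor 1` EQUIVALENT
  (`contactSurplusFloor_iff_transientFloor_one`): the junction surplus and the escape transient are one object, and node A's
  Green–Kubo hypothesis `ContactGreenKubo` is not needed (the tree's `ResponseIdentity` `D_N = (N−1)γE_N` replaces it).

* SPECTRAL SIDE (§8): with the tree's Warburg dip `M_N(ω) = (γ/T²)∫(1 − cos ωu)K_N` (`warburgDip`) and the tree's spectral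
  representation of the `min` kernel, `c₁·Ov_N(t) = ∫_{(0,∞)}(1 − cos ωt)ω⁻² M_N(ω) dω` (`escapeTransient_eq_spectral`), the bracket
  (F₁) ∧ (U) is the two-sided `N`-uniform `√|ω|` (Warburg / Hölder-½) modulus of the boundary noise spectrum at DC: the UPPER cusp
  `WarburgDipCusp` (VERBATIM the strategist's `ContactWarburgModulus` of 9120, whose transfer to `TransientEW` is LANDED) gives (U)
  (`transientCeilingPoint_of_warburgDipCusp`), the LOWER cusp `WarburgDipFloor` (new; phonon-true) gives (F₁)
  (`transientFloor_one_of_warburgDipFloor`; the high band `ω > 1` is PROVED free, `escapeHighBand_ge`, constant `32c₁T²`), and the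
  fixed-`N` sign rung `WarburgDipNonneg` («the boundary noise spectrum peaks at DC»; ⟸ `BoundaryDEP`) gives `Ov_N ≥ 0` at all
  times, hence every `TransientFloor g` and `DeficitCesaroFloor` with constant `0`.  Capstone:
  `boundedResponse_iff_deficitCesaroPoint_of_warburgModulus : WarburgDipFloor → WarburgDipCusp → (BoundedResponse ↔ DeficitCesaroPoint)`
  — under the Warburg modulus, 11071 is EXACTLY «Edwards–Wilkinson at the Thouless time».

Relation to the tree: `…OhmicFloorNecessary.ohmicFloor_of_deficitCesaroEW_of_nonnegTransient` is the SIGN version of the door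
(stub on the whole window ∧ `Ov_N(t) ≥ 0 ∀ t ≥ 0`); this file relaxes both hypotheses to ONE time with `O(N)` slack — the weakest
slack that still closes 11071 — grades the slack, proves the necessity of each relaxed piece modulo the band, and identifies the
floor with node A's junction surplus.  Everything here is sorry-free; the `Prop`s are hypotheses, nothing closes an item.
Tags: (piece · rung) on (D), (F_g), (U), `DeficitCesaroFloor`, (D_h), `ContactSurplusFloor`, the three Warburg Props; (piece · fixed-N)
on (EI); (piece · statics) on `EnergyCorrelationDropLinear` — all hypothesis `Prop`s carry «[route statement · this cell; NOT a
literature fact]»; [folklore] on objects and seams.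
-/

noncomputable section

open MeasureTheory Filter Topology Set
open Literature.MathematicalPhysics.KineticTheory.HeatConduction

namespace Summit.AtomisticToContinuum.FouriersLaw.Theorems.BoundedResponse.TransientBand

open Summit.AtomisticToContinuum.FouriersLaw.Theses.BondHeatUncertainty (BoundedResponse)
open Summit.AtomisticToContinuum.FouriersLaw.Theses.GriffithsLimitExchange (BoundaryDEP)
open Summit.AtomisticToContinuum.FouriersLaw.Theorems.SubdiffusiveBondHeat
  (boundaryKernelBasics_proof pinnedChain_primitive_kinKernel_integral_eq escapeDeficit_nonneg escapeDeficit_le_one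
    boundedResponse_iff_ohmicFloor)
open Summit.AtomisticToContinuum.FouriersLaw.Theorems.SubdiffusiveBondHeat.EscapeGrading
  (escapeDeficit OhmicFloor ExponentFloor ohmicFloor_iff_boundedResponse exponentFloor_one_iff_ohmicFloor)
open Summit.AtomisticToContinuum.FouriersLaw.Theorems.BoundedResponse.TransientContact (contactImbalanceCorr)

/-! ## §0 Real analysis -/

/-- `∫_{(0,∞)} min(u,τ) C(u) du = τ ∫_{(0,∞)} C − ∫₀^τ (τ − u) C(u) du` for `C` integrable on `(0,∞)`, `τ ≥ 0`
(the same lemma as node A's `TransientContact.integral_min_mul_eq_sub`; whichever lands first is cited by the other). [folklore] -/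
theorem integral_min_mul_eq_sub {C : ℝ → ℝ} (hCi : IntegrableOn C (Ioi 0))
    {τ : ℝ} (hτ : 0 ≤ τ) :
    ∫ u in Ioi 0, min u τ * C u =
      τ * (∫ u in Ioi 0, C u) - ∫ u in (0 : ℝ)..τ, (τ - u) * C u := by
  have hpt : ∀ u ∈ Ioi (0 : ℝ),
      min u τ * C u = τ * C u - (Iic τ).indicator (fun u => (τ - u) * C u) u := by
    intro u _
    by_cases h : u ≤ τ
    · rw [indicator_of_mem (show u ∈ Iic τ from h), min_eq_left h]; ring
    · rw [indicator_of_notMem (show u ∉ Iic τ from h), min_eq_right (le_of_not_ge h)]; ring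
  have hi1 : IntegrableOn (fun u => τ * C u) (Ioi 0) := hCi.const_mul τ
  have hi2 : IntegrableOn (fun u => (τ - u) * C u) (Ioc 0 τ) := by
    have hC' : IntegrableOn C (Ioc 0 τ) := hCi.mono_set Ioc_subset_Ioi_self
    refine Integrable.bdd_mul (c := τ) hC' ?_ ?_
    · exact (measurable_const.sub measurable_id).aestronglyMeasurable
    · refine ae_restrict_of_forall_mem measurableSet_Ioc fun u hu => ?_
      rw [Real.norm_eq_abs, abs_of_nonneg (by linarith [hu.2])]
      linarith [hu.1]
  have hi2' : IntegrableOn (fun u => (Iic τ).indicator (fun u => (τ - u) * C u) u) (Ioi 0) := by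
    rw [IntegrableOn, integrable_indicator_iff measurableSet_Iic, IntegrableOn,
      Measure.restrict_restrict measurableSet_Iic, Iic_inter_Ioi]
    exact hi2
  rw [setIntegral_congr_fun measurableSet_Ioi hpt, integral_sub hi1 hi2', integral_const_mul,
    setIntegral_indicator measurableSet_Iic, Ioi_inter_Iic, intervalIntegral.integral_of_le hτ]

/-! ## §1 The objects (escape currency of route `BoundaryEscapeDeficit`, VERBATIM its `let K / θ / E`) -/

/-- **The boundary kernel `K_N(u) = ∫ (p₀² − T)·P_u(p₀² − T) dμ_T^N`** (constructed `transitionKernel` at equal bath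
temperatures, `gibbsMeasure`; `dite` spelling and junk value `0` at `N = 0` VERBATIM the `let K` of route
`BoundaryEscapeDeficit` and of `EscapeGrading.escapeDeficit`). [folklore] -/
def escapeKernel (ω₂ lam β γ T : ℝ) (N : ℕ) (u : ℝ) : ℝ :=
  if h : 0 < N then
    ∫ z, ((z.2 ⟨0, h⟩) ^ 2 - T) *
        (∫ y, ((y.2 ⟨0, h⟩) ^ 2 - T) ∂((pinnedChain ω₂ lam β γ).transitionKernel N T T u.toNNReal z))
      ∂((pinnedChain ω₂ lam β γ).gibbsMeasure N T)
  else 0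

/-- **The step response `θ_N(s) = (γ/T²)∫₀ˢ K_N`** (normalised rise of the contact kinetic temperature after raising bath `0`).
[folklore] -/
def stepResponse (ω₂ lam β γ T : ℝ) (N : ℕ) (s : ℝ) : ℝ :=
  γ / T ^ 2 * ∫ u in (0 : ℝ)..s, escapeKernel ω₂ lam β γ T N u

/-- **The Cesàro deficit `W_N(t) = ∫₀ᵗ (1 − θ_N(s)) ds`** — the functional of the registered open stub `stub_deficitCesaroEW`
of crux 9120 (`W_N(t) ≤ C√t` on `[1, cN²]`). [folklore] -/
def deficitCesaro (ω₂ lam β γ T : ℝ) (N : ℕ) (t : ℝ) : ℝ :=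
  ∫ s in (0 : ℝ)..t, (1 - stepResponse ω₂ lam β γ T N s)

/-- **The escape transient `Ov_N(t) = (γ/T²) ∫_{(0,∞)} min(u,t) K_N(u) du`** — for `t ≥ 0` equal to
`W_N(t) − t·E_N = ∫₀ᵗ (θ_N(∞) − θ_N(s)) ds` (`deficitCesaro_eq_add`, `integral_transient_eq`): the once-integrated
TRANSIENT of the (S)-line (`…OhmicFloorNecessary`, `…IffBoundedResponse` hypothesis `TransientEW`), given a name.
Sign-indefinite in general (`(2/π)∫min(u,t)K = ∫(1 − cos ωt)ω⁻²·(K̂(0) − K̂(ω)) dω`, a DIP functional). [folklore] -/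
def escapeTransient (ω₂ lam β γ T : ℝ) (N : ℕ) (t : ℝ) : ℝ :=
  γ / T ^ 2 * ∫ u in Set.Ioi (0 : ℝ), min u t * escapeKernel ω₂ lam β γ T N u

/-- `E_N = 1 − (γ/T²)∫_{(0,∞)} K_N` — `EscapeGrading.escapeDeficit` in the kernel's name (definitional). [folklore] -/
theorem escapeDeficit_eq (ω₂ lam β γ T : ℝ) (N : ℕ) :
    escapeDeficit ω₂ lam β γ T N = 1 - γ / T ^ 2 * ∫ u in Set.Ioi (0 : ℝ), escapeKernel ω₂ lam β γ T N u := rfl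

/-- `escapeKernel_of_pos` (docstring added by the landing lane; see the module docstring). [formal bookkeeping] -/
theorem escapeKernel_of_pos {ω₂ lam β γ T : ℝ} {N : ℕ} (hN : 0 < N) (u : ℝ) :
    escapeKernel ω₂ lam β γ T N u =
      ∫ z, ((z.2 ⟨0, hN⟩) ^ 2 - T) *
          (∫ y, ((y.2 ⟨0, hN⟩) ^ 2 - T) ∂((pinnedChain ω₂ lam β γ).transitionKernel N T T u.toNNReal z))
        ∂((pinnedChain ω₂ lam β γ).gibbsMeasure N T) := by
  rw [escapeKernel, dif_pos hN]

/-- `escapeKernel_zero` (docstring added by the landing lane; see the module docstring). [formal bookkeeping] -/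
@[simp] theorem escapeKernel_zero (ω₂ lam β γ T : ℝ) (u : ℝ) : escapeKernel ω₂ lam β γ T 0 u = 0 := by
  rw [escapeKernel, dif_neg (lt_irrefl 0)]

/-! ## §2 Fixed-`N` facts (tree: `BoundaryKernelBasics` 12239, the triangle identity of `…DeficitCesaroLinear`) -/

section FixedN

variable {ω₂ lam β γ T : ℝ} (hω : 0 < ω₂) (hl : 0 < lam) (hβ : 0 < β) (hγ : 0 < γ) (hT : 0 < T)
include hω hl hβ hγ hT

/-- `K_N` is continuous (12239 (b); trivially at `N = 0`). [folklore] -/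
theorem continuous_escapeKernel (N : ℕ) : Continuous (escapeKernel ω₂ lam β γ T N) := by
  rcases Nat.eq_zero_or_pos N with rfl | hN
  · rw [show escapeKernel ω₂ lam β γ T 0 = fun _ => 0 from funext (escapeKernel_zero ω₂ lam β γ T)]
    exact continuous_const
  · obtain ⟨-, hKc, -, -, -⟩ := boundaryKernelBasics_proof ω₂ lam β γ hω hl hβ hγ T hT N hN
    exact hKc

/-- `|K_N(u)| ≤ 2T²` (12239 (c)). [folklore] -/
theorem abs_escapeKernel_le (N : ℕ) (u : ℝ) : |escapeKernel ω₂ lam β γ T N u| ≤ 2 * T ^ 2 := by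
  rcases Nat.eq_zero_or_pos N with rfl | hN
  · simp only [escapeKernel_zero, abs_zero]; positivity
  · obtain ⟨-, -, hKb, -, -⟩ := boundaryKernelBasics_proof ω₂ lam β γ hω hl hβ hγ T hT N hN
    exact hKb u

/-- `K_N ∈ L¹(0,∞)` (12239 (e)). [folklore] -/
theorem integrableOn_escapeKernel (N : ℕ) : IntegrableOn (escapeKernel ω₂ lam β γ T N) (Ioi 0) := by
  rcases Nat.eq_zero_or_pos N with rfl | hN
  · rw [show escapeKernel ω₂ lam β γ T 0 = fun _ => 0 from funext (escapeKernel_zero ω₂ lam β γ T)]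
    exact integrableOn_zero
  · obtain ⟨-, -, -, -, hKi⟩ := boundaryKernelBasics_proof ω₂ lam β γ hω hl hβ hγ T hT N hN
    exact hKi

/-- `θ_N` is continuous. [folklore] -/
theorem continuous_stepResponse (N : ℕ) : Continuous (stepResponse ω₂ lam β γ T N) :=
  continuous_const.mul (intervalIntegral.continuous_primitive
    (fun a b => (continuous_escapeKernel hω hl hβ hγ hT N).intervalIntegrable a b) 0)

/-- **`W_N(t) = t·E_N + Ov_N(t)`** for `t ≥ 0` (every `N`; at `N = 0` both sides are `t`): the triangle identity
`∫₀ᵗ∫₀ˢ K = ∫₀ᵗ (t − r) K(r) dr` (tree) and `∫_{(0,∞)} min(u,t) K = t∫_{(0,∞)} K − ∫₀ᵗ (t − u) K`. [folklore] -/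
theorem deficitCesaro_eq_add (N : ℕ) {t : ℝ} (ht : 0 ≤ t) :
    deficitCesaro ω₂ lam β γ T N t = t * escapeDeficit ω₂ lam β γ T N + escapeTransient ω₂ lam β γ T N t := by
  rcases Nat.eq_zero_or_pos N with rfl | hN
  · simp [deficitCesaro, stepResponse, escapeTransient, escapeDeficit_eq]
  have hKc := continuous_escapeKernel hω hl hβ hγ hT N
  have hKi := integrableOn_escapeKernel hω hl hβ hγ hT N
  have hθi : IntervalIntegrable (stepResponse ω₂ lam β γ T N) volume 0 t :=
    (continuous_stepResponse hω hl hβ hγ hT N).intervalIntegrable 0 t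
  have htri : ∫ s in (0 : ℝ)..t, stepResponse ω₂ lam β γ T N s =
      γ / T ^ 2 * ∫ r in (0 : ℝ)..t, (t - r) * escapeKernel ω₂ lam β γ T N r := by
    simp only [stepResponse, escapeKernel_of_pos hN]
    rw [intervalIntegral.integral_const_mul, pinnedChain_primitive_kinKernel_integral_eq hω hl hβ hγ hT hN ht]
  have hmin := integral_min_mul_eq_sub hKi ht
  unfold deficitCesaro escapeTransient
  rw [intervalIntegral.integral_sub intervalIntegrable_const hθi, intervalIntegral.integral_const, htri, hmin,
    escapeDeficit_eq, sub_zero, smul_eq_mul, mul_one]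
  ring

/-- **`∫₀ᵗ ((1 − θ_N(s)) − E_N) ds = Ov_N(t)`** for `t ≥ 0`: the transient integrand of `…OhmicFloorNecessary` /
`TransientEW`, integrated, IS the escape transient. [folklore] -/
theorem integral_transient_eq (N : ℕ) {t : ℝ} (ht : 0 ≤ t) :
    ∫ s in (0 : ℝ)..t, ((1 - stepResponse ω₂ lam β γ T N s) - escapeDeficit ω₂ lam β γ T N) =
      escapeTransient ω₂ lam β γ T N t := by
  have hθi : IntervalIntegrable (fun s => 1 - stepResponse ω₂ lam β γ T N s) volume 0 t :=
    intervalIntegrable_const.sub ((continuous_stepResponse hω hl hβ hγ hT N).intervalIntegrable 0 t)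
  rw [intervalIntegral.integral_sub hθi intervalIntegrable_const, intervalIntegral.integral_const, sub_zero,
    smul_eq_mul]
  have := deficitCesaro_eq_add hω hl hβ hγ hT N ht
  unfold deficitCesaro at this
  rw [this]; ring

/-- `θ_N(s) ≤ 1 − E_N` for `s ≥ 0` when `K_N ≥ 0` on `[0,∞)` (monotone primitive of a nonnegative integrable kernel).
[folklore] -/
theorem stepResponse_le_of_kernel_nonneg (N : ℕ) (hK : ∀ u : ℝ, 0 ≤ u → 0 ≤ escapeKernel ω₂ lam β γ T N u)
    {s : ℝ} (hs : 0 ≤ s) : stepResponse ω₂ lam β γ T N s ≤ 1 - escapeDeficit ω₂ lam β γ T N := by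
  rw [escapeDeficit_eq, sub_sub_cancel, stepResponse, intervalIntegral.integral_of_le hs]
  refine mul_le_mul_of_nonneg_left ?_ (by positivity)
  refine setIntegral_mono_set (integrableOn_escapeKernel hω hl hβ hγ hT N) ?_ Ioc_subset_Ioi_self.eventuallyLE
  exact ae_restrict_of_forall_mem measurableSet_Ioi fun u hu => hK u (le_of_lt hu)

end FixedN

end Summit.AtomisticToContinuum.FouriersLaw.Theorems.BoundedResponse.TransientBand

end
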